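import Summits.CriticalPhenomena.Ising3DConformalLimit.Theorems.HelsonAxisTwoPointSpineComplementShared
import Summits.CriticalPhenomena.Ising3DConformalLimit.Theorems.PrimaryAtInfinityTwoPointPowerLawEta
import Literature.Probability.LatticeModels.CriticalTwoPointLawDimension
import HarnessLib

/-!
# Crux `InverseSquareTelemetry.TwoPointSpineComplement` (stmt-CriticalPhenomena-4497), line `registered`, lead c5:
# the η-FREE payer edges and the exact FOUR-item split (C) ↔ (0634 → 4738 ∧ 1982 ∧ 5354 ∧ 2601)

THEOREM-ONLY helper file (`--supports stmt-CriticalPhenomena-4497`; no definition, no named fact, no `sorry`), sibling of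
`…TwoPointSpineComplementSplit.lean` (p150831: (C) ↔ (0634 → 4738 ∧ 1982 ∧ 0636)) and `…HalfEdgeEdges.lean` (p150645: payer
edges of the corner stub α″ `NoCoulombLaw`).

What is new (2026-08-17): the tree theorem `twoPoint_structure_of_limit` (`Theorems/PrimaryAtInfinityTwoPointPowerLawEta.lean`)
says that EVERY non-degenerate pointwise scaling limit of `criticalCorr 3` has, after normalisation off the diagonals, a
scaling dimension `Δ ∈ [1/2, 3/4]`, the logarithmic exponent `η = 2Δ − 1` and an isotropic pure-power two-point function, and
`twoPointPowerLawEta_iff_half_lt_delta` reduces item stmt-5354 `PrimaryAtInfinity.TwoPointPowerLawEta` to `Δ > 1/2` for every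
such limit. Consequently the non-Gaussianity item stmt-0636 factors EXACTLY as 5354 ∧ 2601 (strategist line `eta-free-split`
of crux 0636, `Cruxes/IsingEuclidUpgradeR4NonGaussian/Lines/eta_free_split.lean`, not importable from `Theorems/`). For the
registered skeleton v3 of THIS crux (stubs D₂, I₂, α″, β, γ) this gives two new by-name payer edges and a finer split:

* `r4NonGaussian_of_twoPointPowerLawEta_of_gaussianLimitIsFree` — 5354 → 2601 → 0636 (importable copy of the `eta-free-split`
  composition, in the `PrecisionLaplacian` spelling of item 0636 used by `Split.TwoPointSpineComplement_of_subs`);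
* `noCoulombLaw_of_limitExists_of_twoPointPowerLawEta` — **edge 4738 ∧ 5354 ⟹ α″** (`stub_noCoulombLaw`): under the exact
  Coulomb law a limit (item 4738) has dimension `1/2` (`scalingDimension_eq_of_twoPointLaw`), contradicting `Δ > 1/2`;
* `hasNontrivialU4_of_gaussianLimitIsFree_of_half_lt` and **`stub_noGaussianWindowLimit_of_gaussianLimitIsFree`** — **edge
  2601 ⟹ β** by name and signature (the corner γ ⇐ 2601 is the landed
  `PerfectScreening…FatSpreadCluster.noMarginalGaussianLimit_of_gaussianLimitIsFree`, p102368);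
* `TwoPointSpineComplement_of_etaFree_subs` — glue 4738 → 1982 → 5354 → 2601 → (C) (header on one line), and
  `twoPointSpineComplement_iff_etaFree_subs` — EXACTNESS: `(C) ↔ (0634 → 4738 ∧ 1982 ∧ 5354 ∧ 2601)`: under the two-point law
  the crux is precisely existence (4738), inversion covariance (1982), `η > 0` for limits (5354) and "a Gaussian limit is free"
  (2601) — four EXISTING, independently staffed items of four different kinds;
* `helsonAxis_TwoPointSpineComplement_of_etaFree_subs`, `helsonAxis_twoPointSpineComplement_iff_etaFree_subs` — the same for the
  byte-identical HelsonAxis copy of the shared item.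

Nothing here is new mathematics; the four children are open problems of the critical `ℤ³` Ising model (Duminil-Copin,
ICM 2022, §8.4: existence, conformal covariance, `η > 0`, non-Gaussianity of the scaling limit).
-/

noncomputable section

namespace Summit.CriticalPhenomena.Ising3DConformalLimit.InverseSquareTelemetryTwoPointSpineComplement.EtaFree

open Literature.Probability.LatticeModels Filter Topology
open Summit.CriticalPhenomena.Ising3DConformalLimit.Theses
open Summit.CriticalPhenomena.Ising3DConformalLimit.Theses.InverseSquareTelemetry
  (TwoPointSpineComplement IsingEuclidUpgradeR2RotInvPowerLaw)
open Summit.CriticalPhenomena.Ising3DConformalLimit.Theses.PrecisionLaplacian (IsingEuclidUpgradeR4NonGaussian)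
open Summit.CriticalPhenomena.Ising3DConformalLimit.MoebiusLimitExistsNegative
  (normalised_hasLimit normalised_nondeg hasNontrivialU4_normalised_iff exists_scaleCovariant_normalised
   isTranslationInvariant_normalised_of_limit)
open Summit.CriticalPhenomena.Ising3DConformalLimit.Theorems.PrimaryAtInfinityTwoPointPowerLawEta
  (twoPointPowerLawEta_iff_half_lt_delta twoPointPowerLawEta_of_nonGaussian)
open Summit.CriticalPhenomena.Ising3DConformalLimit.InverseSquareTelemetryTwoPointSpineComplement.Split
  (TwoPointSpineComplement_of_subs twoPointSpineComplement_iff_subs)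

/-! ### 0636 ⇐ 5354 ∧ 2601 (importable copy of the `eta-free-split` composition) -/

open Classical in
/-- **5354 → 2601 → 0636.** `TwoPointPowerLawEta` (item stmt-5354: every non-degenerate limit has `Δ > 1/2`) and
`GaussianLimitIsFree` (item stmt-2601: a non-degenerate translation-invariant scale-covariant limit with `U₄ ≡ 0` has
`Δ = 1/2`) give `IsingEuclidUpgradeR4NonGaussian` (item stmt-0636, `PrecisionLaplacian` spelling): normalise `S` off the
diagonals (same limit, same `U₄`; translation invariant; scale covariant with some `Δ` — all landed), read `1/2 < Δ` from
5354 and `Δ = 1/2` from 2601 if `U₄ ≡ 0`. This is the composition of the registered strategist line `eta-free-split` of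
crux 0636 (2026-08-17), copied here so that it is importable from `Theorems/`. [folklore] -/
theorem r4NonGaussian_of_twoPointPowerLawEta_of_gaussianLimitIsFree
    (h5354 : PrimaryAtInfinity.TwoPointPowerLawEta) (h2601 : AnomalousForcesInteraction.GaussianLimitIsFree) :
    IsingEuclidUpgradeR4NonGaussian := by
  intro ρ S hρ hlim hnd
  have h' := twoPointPowerLawEta_iff_half_lt_delta.1 h5354
  have hlim' := normalised_hasLimit hlim
  have hnd' := normalised_nondeg hnd
  have htr' := isTranslationInvariant_normalised_of_limit hlim
  obtain ⟨Δ, -, hsc'⟩ := exists_scaleCovariant_normalised hρ hlim hnd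
  have hΔ : 1 / 2 < Δ := h' ρ S Δ hρ hlim hnd hsc'
  by_contra hU4
  have hU4' : ¬ HasNontrivialU4 (fun n x => if x ∈ NonCoincident 3 n then S n x else 0) :=
    fun h => hU4 (hasNontrivialU4_normalised_iff.1 h)
  have hhalf : Δ = 1 / 2 := h2601 ρ Δ _ hρ hlim' hnd' htr' hsc' hU4'
  linarith

/-! ### Edge 4738 ∧ 5354 ⟹ α″ (`stub_noCoulombLaw`) -/

open Classical in
/-- **Edge 4738 ∧ 5354 ⟹ α″.** Bare existence of one non-degenerate pointwise limit (item stmt-4738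
`WeylWindow.LimitExists`) together with `TwoPointPowerLawEta` (item stmt-5354) excludes the exact Coulomb law
`⟨σ₀σ_x⟩_{β_c(3)}·|x|₂ → c > 0`: under that law every non-degenerate limit has scaling dimension exactly `1/2`
(`scalingDimension_eq_of_twoPointLaw`, applied to the normalised family, which is scale covariant by
`exists_scaleCovariant_normalised`), while 5354 forces `Δ > 1/2` (`twoPointPowerLawEta_iff_half_lt_delta`). [folklore] -/
theorem noCoulombLaw_of_limitExists_of_twoPointPowerLawEta (hL : WeylWindow.LimitExists)
    (h5354 : PrimaryAtInfinity.TwoPointPowerLawEta) :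
    ∀ c : ℝ, 0 < c → ¬ Tendsto (fun x : Site 3 =>
      criticalTwoPoint 3 x * Real.sqrt (∑ i, ((x i : ℝ)) ^ 2) ^ (2 * (1 / 2 : ℝ))) cofinite (nhds c) := by
  intro c hc hP
  obtain ⟨ρ, S, hρ, hlim, hnd⟩ := hL
  have hlim' := normalised_hasLimit hlim
  have hnd' := normalised_nondeg hnd
  obtain ⟨Δ, -, hsc'⟩ := exists_scaleCovariant_normalised hρ hlim hnd
  have hgt : 1 / 2 < Δ := (twoPointPowerLawEta_iff_half_lt_delta.1 h5354) ρ S Δ hρ hlim hnd hsc'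
  have heq : Δ = 1 / 2 := scalingDimension_eq_of_twoPointLaw hc hP hlim' hsc' hnd'
  linarith

/-! ### Edge 2601 ⟹ β (`stub_noGaussianWindowLimit`), and the whole half-line `Δ > 1/2` -/

/-- **2601 ⟹ `U₄ ≢ 0` for every Möbius-covariant non-degenerate limit with `Δ > 1/2`.** A Möbius-covariant family is
translation invariant and scale covariant, so `GaussianLimitIsFree` (item stmt-2601) forces `Δ = 1/2` whenever `U₄ ≡ 0`;
hence `U₄ ≢ 0` as soon as `1/2 < Δ`. This pays the window stub β (`1/2 < Δ < 3/4`) and the corner stub γ (`Δ = 3/4`) of the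
registered skeleton at once. [folklore] -/
theorem hasNontrivialU4_of_gaussianLimitIsFree_of_half_lt (h2601 : AnomalousForcesInteraction.GaussianLimitIsFree)
    {ρ : ℝ → ℝ} {Δ : ℝ} {S : CorrFamily 3} (hρ : ∀ δ ∈ Set.Ioc (0:ℝ) 1, 0 < ρ δ)
    (hlim : HasPointwiseScalingLimit (criticalCorr 3) ρ S) (hnd : IsNondegenerateTwoPoint S)
    (hM : IsMoebiusCovariant Δ S) (hΔ : 1 / 2 < Δ) : HasNontrivialU4 S := by
  by_contra hU4
  have hhalf : Δ = 1 / 2 :=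
    h2601 ρ Δ S hρ hlim hnd hM.isEuclideanInvariant.1 hM.isScaleCovariant hU4
  linarith

/-- **Edge 2601 ⟹ β, by name and signature** (the registered stub `stub_noGaussianWindowLimit` of skeleton v3 of this
crux, shared verbatim with crux stmt-13886 `GaussianLimitNotScreened`): `GaussianLimitIsFree` (item stmt-2601) implies that
every non-degenerate Möbius-covariant pointwise limit of `criticalCorr 3` with `1/2 < Δ < 3/4` has `U₄ ≢ 0`. (The corner
γ ⇐ 2601 is the landed `noMarginalGaussianLimit_of_gaussianLimitIsFree`, p102368.) [folklore] -/
theorem stub_noGaussianWindowLimit_of_gaussianLimitIsFree (h2601 : AnomalousForcesInteraction.GaussianLimitIsFree) :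
    ∀ (ρ : ℝ → ℝ) (Δ : ℝ) (S : CorrFamily 3), (∀ δ ∈ Set.Ioc (0:ℝ) 1, 0 < ρ δ) →
      HasPointwiseScalingLimit (criticalCorr 3) ρ S → IsNondegenerateTwoPoint S →
      IsMoebiusCovariant Δ S → 1 / 2 < Δ → Δ < 3 / 4 → HasNontrivialU4 S :=
  fun _ρ _Δ _S hρ hlim hnd hM h₁ _h₂ => hasNontrivialU4_of_gaussianLimitIsFree_of_half_lt h2601 hρ hlim hnd hM h₁

/-! ### The exact four-item split (C) ↔ (0634 → 4738 ∧ 1982 ∧ 5354 ∧ 2601) -/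

/-- **Glue of the η-free split (header on one line).** Items 4738 → 1982 → 5354 → 2601 → (C): the last two give item 0636
(`r4NonGaussian_of_twoPointPowerLawEta_of_gaussianLimitIsFree`), and `Split.TwoPointSpineComplement_of_subs` (p150831) finishes. [cite: DuminilCopinICM2022, §8.4 p. 29] -/
theorem TwoPointSpineComplement_of_etaFree_subs : Summit.CriticalPhenomena.Ising3DConformalLimit.Theses.WeylWindow.LimitExists → Summit.CriticalPhenomena.Ising3DConformalLimit.Theses.HyperoctahedralRP.InversionUpgradeNormalised → Summit.CriticalPhenomena.Ising3DConformalLimit.Theses.PrimaryAtInfinity.TwoPointPowerLawEta → Summit.CriticalPhenomena.Ising3DConformalLimit.Theses.AnomalousForcesInteraction.GaussianLimitIsFree → Summit.CriticalPhenomena.Ising3DConformalLimit.Theses.InverseSquareTelemetry.TwoPointSpineComplement :=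
  fun hL hI h5354 h2601 =>
    TwoPointSpineComplement_of_subs hL hI (r4NonGaussian_of_twoPointPowerLawEta_of_gaussianLimitIsFree h5354 h2601)

/-- **Exactness of the η-free split: (C) ↔ (item 0634 → items 4738 ∧ 1982 ∧ 5354 ∧ 2601).** `→`: by
`Split.twoPointSpineComplement_iff_subs` (C) gives 4738, 1982 and 0636 under 0634; 0636 gives 5354
(`twoPointPowerLawEta_of_nonGaussian`) and 2601 (vacuously: no non-degenerate limit has `U₄ ≡ 0`). `←`: the glue
`TwoPointSpineComplement_of_etaFree_subs` at a law witness. So under the two-point law the crux is EXACTLY existence (4738),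
inversion covariance (1982), `η > 0` for limits (5354) and "a Gaussian limit is free" (2601). [cite: DuminilCopinICM2022, §8.4 p. 29] -/
theorem twoPointSpineComplement_iff_etaFree_subs :
    TwoPointSpineComplement ↔
      (IsingEuclidUpgradeR2RotInvPowerLaw →
        WeylWindow.LimitExists ∧ HyperoctahedralRP.InversionUpgradeNormalised ∧
          PrimaryAtInfinity.TwoPointPowerLawEta ∧ AnomalousForcesInteraction.GaussianLimitIsFree) := by
  constructor
  · intro h hP
    obtain ⟨hL, hI, hN⟩ := twoPointSpineComplement_iff_subs.1 h hP
    refine ⟨hL, hI, twoPointPowerLawEta_of_nonGaussian (fun ρ S hρ hlim hnd => hN ρ S hρ hlim hnd), ?_⟩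
    intro ρ Δ S hρ hlim hnd _ _ hU4
    exact absurd (hN ρ S hρ hlim hnd) hU4
  · intro h Δ c hc hP
    obtain ⟨hL, hI, h5354, h2601⟩ := h ⟨Δ, c, hc, hP⟩
    exact TwoPointSpineComplement_of_etaFree_subs hL hI h5354 h2601 Δ c hc hP

/-- Under the two-point law (item 0634) the crux implies item 5354 (a necessity of the η-free split). [folklore] -/
theorem twoPointPowerLawEta_of_crux (h : TwoPointSpineComplement) (hP : IsingEuclidUpgradeR2RotInvPowerLaw) :
    PrimaryAtInfinity.TwoPointPowerLawEta :=
  (twoPointSpineComplement_iff_etaFree_subs.1 h hP).2.2.1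

/-- Under the two-point law (item 0634) the crux implies item 2601 (a necessity of the η-free split). [folklore] -/
theorem gaussianLimitIsFree_of_crux (h : TwoPointSpineComplement) (hP : IsingEuclidUpgradeR2RotInvPowerLaw) :
    AnomalousForcesInteraction.GaussianLimitIsFree :=
  (twoPointSpineComplement_iff_etaFree_subs.1 h hP).2.2.2

/-! ### The same for the HelsonAxis copy of the shared item -/

/-- **η-free split glue for the HelsonAxis copy (header on one line)**: items 4738 → 1982 → 5354 → 2601 → (C) concluding
`Theses.HelsonAxis.TwoPointSpineComplement` (byte-identical to the InverseSquareTelemetry decl). [cite: DuminilCopinICM2022, §8.4 p. 29] -/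
theorem helsonAxis_TwoPointSpineComplement_of_etaFree_subs : Summit.CriticalPhenomena.Ising3DConformalLimit.Theses.WeylWindow.LimitExists → Summit.CriticalPhenomena.Ising3DConformalLimit.Theses.HyperoctahedralRP.InversionUpgradeNormalised → Summit.CriticalPhenomena.Ising3DConformalLimit.Theses.PrimaryAtInfinity.TwoPointPowerLawEta → Summit.CriticalPhenomena.Ising3DConformalLimit.Theses.AnomalousForcesInteraction.GaussianLimitIsFree → Summit.CriticalPhenomena.Ising3DConformalLimit.Theses.HelsonAxis.TwoPointSpineComplement :=
  TwoPointSpineComplement_of_etaFree_subs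

/-- **Exactness of the η-free split for the HelsonAxis copy: (C) ↔ (0634 → 4738 ∧ 1982 ∧ 5354 ∧ 2601).** [cite: DuminilCopinICM2022, §8.4 p. 29] -/
theorem helsonAxis_twoPointSpineComplement_iff_etaFree_subs :
    HelsonAxis.TwoPointSpineComplement ↔
      (IsingEuclidUpgradeR2RotInvPowerLaw →
        WeylWindow.LimitExists ∧ HyperoctahedralRP.InversionUpgradeNormalised ∧
          PrimaryAtInfinity.TwoPointPowerLawEta ∧ AnomalousForcesInteraction.GaussianLimitIsFree) :=
  twoPointSpineComplement_iff_etaFree_subs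

end Summit.CriticalPhenomena.Ising3DConformalLimit.InverseSquareTelemetryTwoPointSpineComplement.EtaFree

end
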